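import Literature.NumberTheory.EllipticCurves.Kato2004.IwasawaH2Descent
import Literature.NumberTheory.EllipticCurves.MordellWeil
import Literature.NumberTheory.EllipticCurves.Sha
import HarnessLib

/-!
# Kato 2004 (Astérisque 295) §14.9 (14.9.3), (14.9.5) and §14.14 (14.14.1)–(14.14.2) READ IN THE
# RANK-ONE `Ш[p^∞]`-FINITE CASE: the image of `𝐇¹_Γ(T_pW)/T` has FINITE INDEX in `H¹(ℤ[1/p], T_pW)`
# — ONE named fact on PINNED objects, and its PROVED consequence `𝐇²_Γ/T·𝐇²_Γ` finite on every
# descent package `Kato2004.IwasawaH2Data` (the road's reading (3.1'))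

Topic `NumberTheory/EllipticCurves`, sub-directory `Kato2004` (namespace = path).  Cell `bsd-cn100`,
typer seat `bsd-cn100-ty` (g7).  Companion of `Kato2004/IwasawaH2Descent.lean` (the pure Kato
construction package `IwasawaH2Data` / `nonempty_iwasawaH2Data`): the review of that file's first
filing (p459789) asked that the rank-one finiteness of `𝐇²_Γ/T·𝐇²_Γ` — the binder `h31` of
`Summits/…/Theorems/CongruentShaFreeCutKatoZetaRoad.lean`, reading (3.1') of the Kato–zeta road to crux B
of routes `CongruentShaFreeCut` / `MordellShaFreeCut` — be stated separately with its own sources,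
because the one-sentence print of it in Burungale–Skinner (App. A to arXiv:2210.10730, §10.1.3: "By the
assumption, `Sel_st(E)` is finite. The same is then true of `X_st(E)/(γ−1)X_st(E)`") stands under "Let
`E` be as in Theorem 10.1", i.e. `E` CM and `p` SUPERSINGULAR, whereas the road needs it for `E_n` at the
ADDITIVE prime `2`.  This file states it ON PINNED OBJECTS ONLY (no abstract module in the statement)
from KATO'S GENERAL statements, and PROVES its transport to every package.

## The statement and its sources (K. Kato, Astérisque 295 (2004); `[p. N]` = printed page; store key
`paper:doi-10-24033-ast-639`, PDF page `N − 115`; read 2026-08-26)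

FACT `finite_descentCokernel_of_rankOne`: for every elliptic curve `W/ℚ`, prime `p`, cyclotomic `κ`
with topological generator `γ` and pinned `I : IwasawaH1Data W p κ γ`: if `rank_ℤ W(ℚ) = 1` and
`Ш(W)[p^∞]` is finite, then the image of `proj₀ : 𝐇¹_Γ(T_pW)/T → H¹(ℤ[1/p], T_pW)` (the tree's
`IwasawaH1Data.projZero`, values in `integralH1`, corestricted: `projZeroIntegral`) has FINITE INDEX —
`descentCokernel I := H¹(ℤ[1/p], T_pW) / proj₀(𝐇¹_Γ/T)` is finite.  READING (every step a general
printed statement of Kato for `T = T_pW`, `K = ℚ`, or elementary; none uses CM or the reduction type):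
* (R1) **(14.14.1) [p. 243]** "`0 → 𝐇¹(T)/a𝐇¹(T) → H¹(ℤ[1/p], T) → _a𝐇²(T) → 0`": the cokernel in
  question IS `𝐇²_Γ(T_pW)[T]` (Γ-reading of `IwasawaH2Descent.lean`; on a package:
  `IwasawaH2Data.invariantsEquivCoker`).
* (R2) **(12.2.1) [p. 220] + Thm. 12.4 (1) [p. 221]**: `𝐇²` is a finitely generated TORSION
  `Λ`-module, hence `rank_{ℤ_p} 𝐇²[T] = rank_{ℤ_p} 𝐇²/T·𝐇²` (additivity of `length_{Λ_(T)}` over the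
  finite-length module `𝐇²_(T)`: kernel and cokernel of `T` have the same length — the tree theorem
  `IwasawaAlgebra.lengthAt_invariants_eq_lengthAt_coinvariants`); so the cokernel is finite iff
  `𝐇²_Γ/T·𝐇²_Γ` is finite — PROVED below in both directions (`finite_descentCokernel_iff_finite_coinvariants_H2`).
* (R3) **(14.14.2) [p. 243]** "`𝐇²(T)/a𝐇²(T) ≅ H²(ℤ[1/p], T)`".
* (R4) **§14.9 [pp. 239–240]**, for "`K` a finite extension of `ℚ` … `T` a finitely generated
  `O_L`-module endowed with a continuous `O_L`-linear action of `Gal(K̄/K)` unramified at almost all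
  finite places" with `V` de Rham at `v ∣ p` (true for `T_pE`): **(14.9.3)** "`0 → H¹(O_K[1/p],T)/H¹_f
  → H¹(K ⊗ ℚ_p, T)/H¹_f →(a) S(K, T*(1) ⊗ ℚ/ℤ)^∨ → H²(O_K[1/p], T) → H²(K ⊗ ℚ_p, T) →
  H⁰(O_K[1/p], T*(1) ⊗ ℚ/ℤ)^∨`… which are exact in the case `p ≠ 2`, and exact up to `×2` in the case
  `p = 2`" [p. 240], the local Tate duality "`H^q(K ⊗ ℚ_p, T) ≅ {H^{2−q}(K ⊗ ℚ_p, T*(1) ⊗ ℚ/ℤ)}^∨`"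
  [p. 239] (so `H²(ℚ_p, T_pE) ≅ E(ℚ_p)[p^∞]^∨` is FINITE), and **§14.1 [p. 235]** "If `A` is an abelian
  variety over `K`, the usual Selmer group `Sel(K, A)` of `A` coincides with `Sel(K, T_p(A))`".  The
  map `a` is the Pontryagin dual of the localisation `Sel_{p^∞}(E/ℚ) → H¹_f(ℚ_p, E[p^∞]) =
  E(ℚ_p) ⊗ ℚ_p/ℤ_p` ((14.9.1) is built from Poitou–Tate and local duality), so
  `H²(ℤ[1/p], T_pE)` is finite as soon as `Sel_st(E) := Ker(Sel_{p^∞}(E/ℚ) → E(ℚ_p) ⊗ ℚ_p/ℤ_p)` is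
  finite (at `p = 2` "up to `×2`" changes finitely generated `ℤ_2`-modules by `2`-torsion of finite
  type, i.e. by finite groups, so finiteness is unaffected).  Kato prints this very deduction pattern in
  14.13 [p. 243]: "We prove the finiteness of `H²(ℤ[1/p], T)` … By the sequence (14.9.3), this follows
  from the finiteness of `S(T*(1))` and the finiteness of `H²(ℚ_p, T)`."
* (R5) elementary: if `rank_ℤ E(ℚ) = 1` and `Ш(E)[p^∞]` is finite then `Sel_{p^∞}(E/ℚ) ≅ ℚ_p/ℤ_p ⊕
  (finite)` and `loc_p` is non-zero on its divisible part `E(ℚ) ⊗ ℚ_p/ℤ_p` (a non-torsion rational point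
  is non-torsion in `E(ℚ_p) ≅ ℤ_p × (finite)`, so has non-zero image in `E(ℚ_p) ⊗ ℚ_p/ℤ_p ≅ ℚ_p/ℤ_p`),
  hence `Sel_st(E)` is finite.  [This is the verification "hypotheses (a), (b) of Burungale–Skinner
  Thm. 10.1 hold in the rank-one `Ш[p^∞]`-finite case", checked in the review of p459789.]
Chain: (R5) ⟹ `Sel_st` finite ⟹(R4) `H²(ℤ[1/p], T_pW)` finite ⟹(R3) `𝐇²_Γ/T·𝐇²_Γ` finite ⟹(R2)
`𝐇²_Γ[T]` finite ⟹(R1) the index is finite.  PRINTED INSTANCE of the whole chain's conclusion: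
Burungale–Skinner, App. A §10.1.3 with §10.1.1 ("`X_st(E)` (in the guise of `H²(ℤ[1/p], T ⊗ Λ)`)";
"`Sel_st(E)` is finite. The same is then true of `X_st(E)/(γ−1)X_st(E)`"), for `E` CM and `p`
supersingular (their standing hypotheses; their argument uses neither).  Referee flag:
`Kato-14.9.3-14.14-rank-one-reading` (non-verbatim: the Γ-reading of §14.14 as in
`IwasawaH2Descent.lean`; the identification of `a` with the dual of `loc_p`; step (R5)).

WHY ON PINNED OBJECTS.  `descentCokernel I` mentions only the tree's `IwasawaH1Data`, `integralH1`,
`projZero`; no abstract `𝐇²` occurs in the fact.  Its consequence for ANY package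
`J : IwasawaH2Data W p κ γ I` — `Finite (coinvariants p J.H2)`, the road's `h31` — is a THEOREM here
(`IwasawaH2Data.finite_coinvariants_H2_of_rankOne`), through the proved equivalence
`Finite (descentCokernel I) ↔ Finite (coinvariants p J.H2)` ((R1)+(R2) in Lean: `invariantsEquivCoker`,
the `A`-pin, and the tree's `lengthAt` calculus).  In particular the fact is exactly as strong as "(3.1')
for Kato's genuine `𝐇²_Γ(T_pW)`", neither more nor less.

HONEST FRAMING: one named fact (D-0014; review-queued; net debt +1), everything else PROVED; BSD is
not advanced; the fact is a cited reading of Kato's general theorems (size L if one wanted `_holds`: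
Poitou–Tate for `T_pE` over `ℚ`, the rank-one Selmer computation, (14.14.2)).  No `instance`, no
notation.

## References

* K. Kato, *p-adic Hodge theory and values of zeta functions of modular forms*, Astérisque 295 (2004):
  §12.2 (12.2.1) (p. 220), Thm. 12.4 (1) (p. 221), §14.1 (p. 235), §14.9 (14.9.1)–(14.9.5) and the local
  duality (pp. 239–240), 14.13 (p. 243), §14.14 (14.14.1)–(14.14.2) (p. 243) — store text
  `paper:doi-10-24033-ast-639` pp. 105–106, 120, 124–125, 128. [Kato2004Asterisque]
* A. A. Burungale, C. Skinner, App. A to Alpöge–Bhargava–Shnidman, arXiv:2210.10730: Thm. 10.1,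
  §10.1.1, §10.1.3 — store text `paper:arxiv-2210.10730` pp. 33–34. [AlpogeBhargavaShnidman2022]
* A. A. Burungale, Y. Tian, *A rank zero p-converse to a theorem of Gross–Zagier, Kolyvagin and Rubin*,
  Ann. of Math. (2) 203 (2026), proof of Thm. 3.1 — the REFEREED printed instance of the same descent
  pattern in rank ZERO ("Since `H¹_f(ℚ, V(k/2)) = 0`, by the exact sequence [12, (14.9.3)], note that (3.1)
  `H²(ℤ[1/p], T(k/2)) ⊗ ℚ = 0` … By (3.1) and the Euler–Poincaré formula of Tate [12, (14.9.5)] …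
  `H²(V)_q` vanishes by (3.1) … (See also [12, p. 242].)", for a CM newform of even weight and any
  prime `p`; Rem. 3.2: "holds for any elliptic newform") beside the Burungale–Skinner preprint sentence —
  store text `paper:burungale2025-rank-zero-p-converse-theorem-gross-zagier` p0006:L1–L15, read
  2026-08-27 (ARM P `D-AUDIT-r01-S2.md` bc5f86ec8d2321e2 §6 (a)). [BurungaleTian2026]
* M. F. Lim, *Notes on the fine Selmer groups*, Asian J. Math. 21 (2017) §2 (the Poitou–Tate sequence
  `0 → Y_S(T/𝓛) → lim← H²(G_S(L), T) → (⊕_{v∈S} K⁰_v(W/𝓛))^∨ → W(𝓛)^∨ → 0` for any number field and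
  any `p`) — context for (R4) over `ℚ_∞`; not used in the statement. [Lim2017FineSelmer]
* Tree: `Kato2004/IwasawaH2Descent.lean` (`IwasawaH2Data`, `invariantsEquivCoker`,
  `projZero_injective`), `Kato2004/IwasawaCohomologyLevelZero.lean` (`projZero`, `projZero_mem`),
  `IwasawaEulerCharProofs.lean` (`lengthAt_invariants_eq_lengthAt_coinvariants`,
  `finite_iff_lengthAt_eq_zero_of_X_smul_eq_zero`), `IwasawaCoinvariantsRankProofs.lean`
  (`X_smul_coinvariants`).
-/

noncomputable section

open Field
open Literature.NumberTheory.GaloisRepresentations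
open Literature.NumberTheory.EllipticCurves Literature.NumberTheory.EllipticCurves.Kato2004
open Literature.NumberTheory.EllipticCurves.Kato2004.EulerSystemValues
open Literature.NumberTheory.EllipticCurves.IwasawaAlgebra

namespace Literature.NumberTheory.EllipticCurves.Kato2004

/-! ## §1 The pinned cokernel `H¹(ℤ[1/p], T_pW) / proj₀(𝐇¹_Γ/T)` -/

namespace IwasawaH1Data

variable {W : WeierstrassCurve ℚ} [W.IsElliptic] {p : ℕ} [Fact p.Prime]
  [ContinuousSMul ℤ_[p] (W.tateModule p)] {κ : ZpExtension ℚ p} {γ : absoluteGaloisGroup ℚ}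
  (I : IwasawaH1Data W p κ γ)

/-- `proj₀ : 𝐇¹_Γ/T𝐇¹_Γ → H¹(ℤ[1/p], T_pW)` with its values corestricted to the integral classes
(`projZero_mem`): the first arrow of Kato's (14.14.1) as a map INTO `integralH1`. Plumbing definition.
[cite: Kato2004Asterisque, §14.14 (14.14.1) (p. 243)] -/
def projZeroIntegral :
    coinvariants p I.H →+ integralH1 (tateRep W p) p (κ.layerSubgroup 0) :=
  I.projZero.codRestrict (integralH1 (tateRep W p) p (κ.layerSubgroup 0)).toAddSubgroup
    I.projZero_mem

/-- Unfolding `projZeroIntegral` on underlying classes. [cite: Kato2004Asterisque, §14.14 (14.14.1) (p. 243)] -/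
@[simp] theorem coe_projZeroIntegral (x : coinvariants p I.H) :
    (I.projZeroIntegral x : H1 (tateRep W p) (κ.layerSubgroup 0)) = I.projZero x :=
  rfl

/-- **The descent cokernel `H¹(ℤ[1/p], T_pW) / proj₀(𝐇¹_Γ(T_pW)/T)`** — a PINNED object (the tree's
`integralH1` at level `0` modulo the image of `IwasawaH1Data.projZero`).  By Kato's (14.14.1) it is
`𝐇²_Γ(T_pW)[T]`; on a descent package this is the theorem `IwasawaH2Data.descentCokernelEquiv`.
[cite: Kato2004Asterisque, §14.14 (14.14.1) (p. 243)] -/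
abbrev descentCokernel : Type :=
  integralH1 (tateRep W p) p (κ.layerSubgroup 0) ⧸ I.projZeroIntegral.range

end IwasawaH1Data

/-! ## §2 On a package: `descentCokernel ≃ A/ι(𝐇¹_Γ/T) ≃ 𝐇²_Γ[T]`, and `𝐇²[T]` finite `↔` `𝐇²/T` finite -/

namespace IwasawaH2Data

variable {W : WeierstrassCurve ℚ} [W.IsElliptic] {p : ℕ} [Fact p.Prime]
  [ContinuousSMul ℤ_[p] (W.tateModule p)] {κ : ZpExtension ℚ p} {γ : absoluteGaloisGroup ℚ}
  {I : IwasawaH1Data W p κ γ} (J : IwasawaH2Data W p κ γ I)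

/-- The pin of `A` as an additive map INTO `integralH1` (`toH1` corestricted, `toH1_mem`).
[cite: Kato2004Asterisque, §8.2 and Lemma 8.5 (pp. 180–184)] -/
def toIntegralH1 : J.A →+ integralH1 (tateRep W p) p (κ.layerSubgroup 0) :=
  J.toH1.codRestrict (integralH1 (tateRep W p) p (κ.layerSubgroup 0)).toAddSubgroup J.toH1_mem

/-- Unfolding `toIntegralH1`. [cite: Kato2004Asterisque, §8.2 and Lemma 8.5 (pp. 180–184)] -/
@[simp] theorem coe_toIntegralH1 (a : J.A) :
    (J.toIntegralH1 a : H1 (tateRep W p) (κ.layerSubgroup 0)) = J.toH1 a :=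
  rfl

/-- `toIntegralH1` is bijective (the pin: `toH1` injective with image exactly `integralH1`).
[cite: Kato2004Asterisque, §8.2 and Lemma 8.5 (pp. 180–184)] -/
theorem bijective_toIntegralH1 : Function.Bijective J.toIntegralH1 := by
  refine ⟨fun a b h ↦ J.toH1_injective (by simpa using congrArg Subtype.val h), fun x ↦ ?_⟩
  obtain ⟨a, ha⟩ := J.exists_eq_toH1_of_mem x.2
  exact ⟨a, Subtype.ext ha⟩

/-- **`A ≃ H¹(ℤ[1/p], T_pW)`** as additive groups (the pin of `A`, packaged).
[cite: Kato2004Asterisque, §8.2 and Lemma 8.5 (pp. 180–184)] -/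
def integralH1Equiv : J.A ≃+ integralH1 (tateRep W p) p (κ.layerSubgroup 0) :=
  AddEquiv.ofBijective J.toIntegralH1 J.bijective_toIntegralH1

/-- Unfolding `integralH1Equiv`. [cite: Kato2004Asterisque, §8.2 and Lemma 8.5 (pp. 180–184)] -/
@[simp] theorem coe_integralH1Equiv (a : J.A) :
    (J.integralH1Equiv a : H1 (tateRep W p) (κ.layerSubgroup 0)) = J.toH1 a :=
  rfl

/-- Under the pin of `A`, the image of `ι` is the image of `proj₀` (`toH1 ∘ ι = proj₀`).
[cite: Kato2004Asterisque, §14.14 (14.14.1) (p. 243)] -/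
theorem map_range_ι_eq :
    (LinearMap.range J.ι).toAddSubgroup.map (J.integralH1Equiv : J.A →+ _) =
      I.projZeroIntegral.range := by
  ext x
  constructor
  · rintro ⟨a, ⟨y, rfl⟩, rfl⟩
    refine ⟨y, Subtype.ext ?_⟩
    change I.projZero y = J.toH1 (J.ι y)
    rw [J.toH1_ι_projZero]
  · rintro ⟨y, rfl⟩
    refine ⟨J.ι y, ⟨y, rfl⟩, Subtype.ext ?_⟩
    change J.toH1 (J.ι y) = I.projZero y
    rw [J.toH1_ι_projZero]

/-- **`descentCokernel I ≃ A/ι(𝐇¹_Γ/T)`** on a package (the pin transports the two quotients).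
[cite: Kato2004Asterisque, §14.14 (14.14.1) (p. 243)] -/
def descentCokernelEquivCoker : (J.A ⧸ LinearMap.range J.ι) ≃+ I.descentCokernel :=
  QuotientAddGroup.congr (LinearMap.range J.ι).toAddSubgroup I.projZeroIntegral.range
    J.integralH1Equiv J.map_range_ι_eq

/-- **`descentCokernel I ≃ 𝐇²_Γ[T]`** on a package: Kato's (14.14.1) read on the pinned objects.
[cite: Kato2004Asterisque, §14.14 (14.14.1) (p. 243)] -/
def descentCokernelEquiv : I.descentCokernel ≃+ invariants p J.H2 :=
  J.descentCokernelEquivCoker.symm.trans J.invariantsEquivCoker.toAddEquiv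

/-- For a finitely generated torsion `Λ`-module `M`: **`M[T]` is finite iff `M/TM` is finite** (both are
killed by `T`, and `ℓ_(T)(M[T]) = ℓ_(T)(M/TM)` — the tree's `lengthAt_invariants_eq_lengthAt_coinvariants`
with `finite_iff_lengthAt_eq_zero_of_X_smul_eq_zero`).  Step (R2) of the module docstring.
[cite: Kato2004Asterisque, §12.2 (12.2.1) (p. 220) and Thm. 12.4 (1) (p. 221)] -/
theorem finite_invariants_iff_finite_coinvariants (M : Type) [AddCommGroup M]
    [Module (IwasawaAlgebra p) M] [Module.Finite (IwasawaAlgebra p) M]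
    (hM : Module.IsTorsion (IwasawaAlgebra p) M) :
    Finite (invariants p M) ↔ Finite (coinvariants p M) := by
  rw [finite_iff_lengthAt_eq_zero_of_X_smul_eq_zero p (invariants p M) (X_smul_invariants p M),
    finite_iff_lengthAt_eq_zero_of_X_smul_eq_zero p (coinvariants p M) (X_smul_coinvariants p M),
    lengthAt_invariants_eq_lengthAt_coinvariants p M hM]

/-- **On a package, `descentCokernel I` is finite iff `𝐇²_Γ/T·𝐇²_Γ` is finite** ((R1) + (R2)): the
rank-one fact below is EXACTLY the statement "`Finite (coinvariants p J.H2)`" for Kato's genuine package,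
and transports to every package. [cite: Kato2004Asterisque, §14.14 (14.14.1) (p. 243), Thm. 12.4 (1) (p. 221)] -/
theorem finite_descentCokernel_iff_finite_coinvariants_H2 :
    Finite I.descentCokernel ↔ Finite (coinvariants p J.H2) := by
  haveI : Module.Finite (IwasawaAlgebra p) J.H2 := J.finite_H2
  rw [← finite_invariants_iff_finite_coinvariants J.H2 J.isTorsion_H2]
  exact ⟨fun h ↦ Finite.of_equiv _ J.descentCokernelEquiv.toEquiv,
    fun h ↦ Finite.of_equiv _ J.descentCokernelEquiv.symm.toEquiv⟩

end IwasawaH2Data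

/-! ## §3 The named fact ((14.9.3) + (14.14.1)–(14.14.2) in the rank-one `Ш[p^∞]`-finite case) and its consumer form -/

/-- **Kato 2004, (14.14.1)–(14.14.2) (p. 243) with (14.9.3) (p. 240, `K = ℚ`, `T = T_pW`), the local
duality `H²(ℚ_p, T) ≅ H⁰(ℚ_p, T*(1) ⊗ ℚ/ℤ)^∨` (p. 239), §14.1 (p. 235) and (12.2.1)/Thm. 12.4 (1), READ in
the rank-one `Ш[p^∞]`-finite case (module docstring (R1)–(R5); printed instance of the conclusion:
Burungale–Skinner App. A §10.1.3 with §10.1.1, for `E` CM and `p` supersingular): the image of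
`𝐇¹_Γ(T_pW)/T` under `proj₀` has FINITE INDEX in `H¹(ℤ[1/p], T_pW)`.**  For every elliptic curve `W/ℚ`,
every prime `p`, every cyclotomic `ℤ_p`-extension datum `κ` with topological generator `γ` and every
pinned `I : IwasawaH1Data W p κ γ`: if `rank_ℤ W(ℚ) = 1` (`W.mordellWeilRank = 1`) and `Ш(W)[p^∞]` is
finite, then `IwasawaH1Data.descentCokernel I = H¹(ℤ[1/p], T_pW) / proj₀(𝐇¹_Γ/T)` is finite.  By
(14.14.1) this cokernel is `𝐇²_Γ(T_pW)[T]`, which for the finitely generated torsion module `𝐇²_Γ` is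
finite iff `𝐇²_Γ/T·𝐇²_Γ = H²(ℤ[1/p], T_pW)` ((14.14.2)) is, and the latter is finite by (14.9.3) because
`Sel_st(E) = Ker(Sel_{p^∞}(E/ℚ) → E(ℚ_p) ⊗ ℚ_p/ℤ_p)` is finite in rank one with `Ш[p^∞]` finite and
`H²(ℚ_p, T_pE) ≅ E(ℚ_p)[p^∞]^∨` is finite (Kato's own pattern of 14.13, p. 243).  A statement on PINNED
objects only (no abstract module); its transport to every descent package is the theorem
`IwasawaH2Data.finite_coinvariants_H2_of_rankOne` below (= the road's binder `h31`).  Weaker than print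
in scope (only `T_pW`, `K = ℚ`, the rank-one case), never stronger.  Named fact; nothing asserted; no
`_holds` expected soon (size L).  Referee flag `Kato-14.9.3-14.14-rank-one-reading`.  See also, as a
REFEREED printed instance of the same (14.9.3) descent pattern (in rank zero: `Sel = 0 ⇒
H²(ℤ[1/p], T) ⊗ ℚ = 0`, Euler–Poincaré (14.9.5), "[12, p. 242]") beside the Burungale–Skinner preprint
sentence: Burungale–Tian, Ann. of Math. 203 (2026), proof of Thm. 3.1 (ARM P reader sheet
`pub/bsd-cited/sheets/D-AUDIT-r01-S2.md` bc5f86ec8d2321e2 §6 (a); doc item only, statement unchanged).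
[cite: Kato2004Asterisque, §14.14 (14.14.1)–(14.14.2) (p. 243), §14.9 (14.9.3) and local duality (pp. 239–240), 14.13 (p. 243), §14.1 (p. 235), §12.2 (12.2.1) (p. 220), Thm. 12.4 (1) (p. 221)]
[cite: AlpogeBhargavaShnidman2022, App. A §10.1.3 with §10.1.1 and Thm. 10.1 (printed instance: CM, supersingular p)]
[cite: BurungaleTian2026, proof of Thm. 3.1 (refereed instance of the (14.9.3) descent, rank zero, any prime p)] -/
def finite_descentCokernel_of_rankOne : Prop :=
  ∀ (W : WeierstrassCurve ℚ) [W.IsElliptic] (p : ℕ) [Fact p.Prime]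
    [ContinuousSMul ℤ_[p] (W.tateModule p)] (κ : ZpExtension ℚ p) (γ : absoluteGaloisGroup ℚ),
    κ.IsCyclotomic → κ.IsTopGenerator γ → ∀ I : IwasawaH1Data W p κ γ,
      W.mordellWeilRank = 1 → Finite (AddCommGroup.primaryComponent W.sha p) →
        Finite (IwasawaH1Data.descentCokernel I)

/-- **Consumer form = the road's binder `h31` on a package** (reading (3.1') of
`Theorems/CongruentShaFreeCutKatoZetaRoad.lean`): under `finite_descentCokernel_of_rankOne`, for every
cyclotomic `κ`, topological generator `γ`, pinned `I` and descent package `J : IwasawaH2Data W p κ γ I`,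
`rank_ℤ W(ℚ) = 1 ∧ #Ш(W)[p^∞] < ∞ ⟹ 𝐇²_Γ/T·𝐇²_Γ` finite — PROVED from the fact by (14.14.1) on the
pin and the `lengthAt` calculus (`finite_descentCokernel_iff_finite_coinvariants_H2`).
[cite: Kato2004Asterisque, §14.14 (14.14.1)–(14.14.2) (p. 243) and (14.9.3) (p. 240)]
[cite: AlpogeBhargavaShnidman2022, App. A §10.1.3 (printed instance)] -/
theorem IwasawaH2Data.finite_coinvariants_H2_of_rankOne (h : finite_descentCokernel_of_rankOne)
    {W : WeierstrassCurve ℚ} [W.IsElliptic] {p : ℕ} [Fact p.Prime]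
    [ContinuousSMul ℤ_[p] (W.tateModule p)] {κ : ZpExtension ℚ p} {γ : absoluteGaloisGroup ℚ}
    (hκ : κ.IsCyclotomic) (hγ : κ.IsTopGenerator γ) {I : IwasawaH1Data W p κ γ}
    (J : IwasawaH2Data W p κ γ I) (hrank : W.mordellWeilRank = 1)
    (hsha : Finite (AddCommGroup.primaryComponent W.sha p)) : Finite (coinvariants p J.H2) :=
  J.finite_descentCokernel_iff_finite_coinvariants_H2.mp (h W p κ γ hκ hγ I hrank hsha)

end Literature.NumberTheory.EllipticCurves.Kato2004

end
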